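import Literature.Analysis.FluidPDE.CompressibleEulerImplosionBulkClausesTM
import HarnessLib

/-!
# Buckmaster–Cao-Labora–Gómez-Serrano at `γ = 5/3`: the kernel certificate of the eight bulk envelopes

Companion of `…BulkClausesTM` (the seventeen Taylor models `F_…` of the polynomial forms `Pt.Pos` of the bulk
envelopes of the crux `DenseExcursion`, line `sonic-cavity-renewal`, and the soundness theorem `pos_of_bulkChk` of
the boolean check `bulkChk` of one `(c, ζ)`-piece). Here the check is RUN by the kernel (`decide +kernel`) on three
pieces covering the certified range `c ∈ [17/50, 23/50]` of the sonic scale and the bulk `ζ = c eˣ ∈ [c/100, c/2]`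
(`log(1/100) ≤ x ≤ −7/10`, `e^{−7/10} < 1/2`): degree `36`, Taylor-model radius `h = c_hi/2`, bisection depth `6`
(every one of the `3 × 17` sign checks passes at depth `≤ 1`; the generating emulator is `num/cert.py` of the crux).
Main theorem `bulk_pos_window2`: for every `r` in the shooting window, every `c ∈ [17/50, 23/50]` and every
`ζ ∈ [c/100, c/2]` the seventeen sign conditions hold with some `0 < e ≤ 1/c`. No facts, no axioms.

[cite: BuckmasterCaolaboraGomezserrano2025, Prop. 2.5, App. B]
-/

noncomputable section

namespace Literature.Analysis.FluidPDE

namespace BuckmasterCaolaboraGomezserrano2025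

namespace OriginSeries

namespace CentreW2

open Literature.Analysis.ValidatedNumerics Literature.Analysis.ValidatedNumerics.PolyMP
open Literature.Analysis.ValidatedNumerics.NumericsMP

set_option linter.style.longLine false
set_option linter.style.setOption false
set_option maxRecDepth 100000
set_option maxHeartbeats 4000000

/-- Piece 1: `c ∈ [17/50, 19/50]`, `ζ ∈ [17/5000, 19/100]`. [cite: BuckmasterCaolaboraGomezserrano2025, App. B] -/
theorem bulkChk_1 : bulkChk 36 (19 / 100) (17 / 50) (19 / 50) (17 / 5000) 6 = true := by decide +kernel

/-- Piece 2: `c ∈ [19/50, 21/50]`, `ζ ∈ [19/5000, 21/100]`. [cite: BuckmasterCaolaboraGomezserrano2025, App. B] -/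
theorem bulkChk_2 : bulkChk 36 (21 / 100) (19 / 50) (21 / 50) (19 / 5000) 6 = true := by decide +kernel

/-- Piece 3: `c ∈ [21/50, 23/50]`, `ζ ∈ [21/5000, 23/100]`. [cite: BuckmasterCaolaboraGomezserrano2025, App. B] -/
theorem bulkChk_3 : bulkChk 36 (23 / 100) (21 / 50) (23 / 50) (21 / 5000) 6 = true := by decide +kernel

/-- **The seventeen sign conditions on the whole bulk.** For `r` in the shooting window, `c ∈ [17/50, 23/50]` and
`ζ ∈ [c/100, c/2]`: `Pt.Pos` holds at `pt r c ζ` with some `0 < e ≤ 1/c`. [cite: BuckmasterCaolaboraGomezserrano2025, Prop. 2.5, App. B] -/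
theorem bulk_pos_window2 {r c ζ : ℝ} (hr : r ∈ Set.Icc ((13890041/12500000 : ℚ) : ℝ) ((697/625 : ℚ) : ℝ))
    (hc : c ∈ Set.Icc (17 / 50 : ℝ) (23 / 50)) (h1 : c / 100 ≤ ζ) (h2 : ζ ≤ c / 2) :
    ∃ e : ℝ, 0 < e ∧ e ≤ 1 / c ∧ (pt r c ζ).Pos e := by
  obtain ⟨hc1, hc2⟩ := hc
  have hc0 : 0 < c := by linarith
  rcases le_or_gt c (19 / 50) with ha | ha
  · refine ⟨((1 / (19 / 50 : ℚ) : ℚ) : ℝ), by push_cast; norm_num, ?_, ?_⟩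
    · push_cast; rw [div_le_div_iff₀ (by norm_num) hc0]; linarith
    · exact pos_of_bulkChk hr (by norm_num) (by norm_num) (by norm_num [lamQ]) c (clo := 17 / 50) (chi := 19 / 50)
        ⟨by push_cast; linarith, by push_cast; linarith⟩ bulkChk_1 (by norm_num) (by norm_num) (by push_cast; linarith) (by push_cast; linarith)
  rcases le_or_gt c (21 / 50) with hb | hb
  · refine ⟨((1 / (21 / 50 : ℚ) : ℚ) : ℝ), by push_cast; norm_num, ?_, ?_⟩
    · push_cast; rw [div_le_div_iff₀ (by norm_num) hc0]; linarith
    · exact pos_of_bulkChk hr (by norm_num) (by norm_num) (by norm_num [lamQ]) c (clo := 19 / 50) (chi := 21 / 50)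
        ⟨by push_cast; linarith, by push_cast; linarith⟩ bulkChk_2 (by norm_num) (by norm_num) (by push_cast; linarith) (by push_cast; linarith)
  · refine ⟨((1 / (23 / 50 : ℚ) : ℚ) : ℝ), by push_cast; norm_num, ?_, ?_⟩
    · push_cast; rw [div_le_div_iff₀ (by norm_num) hc0]; linarith
    · exact pos_of_bulkChk hr (by norm_num) (by norm_num) (by norm_num [lamQ]) c (clo := 21 / 50) (chi := 23 / 50)
        ⟨by push_cast; linarith, by push_cast; linarith⟩ bulkChk_3 (by norm_num) (by norm_num) (by push_cast; linarith) (by push_cast; linarith)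

end CentreW2

end OriginSeries

end BuckmasterCaolaboraGomezserrano2025

end Literature.Analysis.FluidPDE
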